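import Literature.RingTheory.MvPowerSeries.PartialDerivative
import Literature.RingTheory.MvPowerSeries.MaximalIdealPow
import Literature.RingTheory.MvPowerSeries.FrobeniusPowerBasis
import Mathlib.Algebra.MvPolynomial.PDeriv
import Mathlib.Algebra.CharP.Two
import HarnessLib

/-!
# K-β7-hat W2 (`BranchObstruction`), block γ — the NORMAL FORM of `∂F` in hat coordinates (W4.1, OURS)

Third kernel block of the heart W2 (res-L0-w41-idea-1 `K7HatWords-idea-1-g12.lean` cbdb8a4f311bfcb9 l.223;
memo `CANONICAL-CLEANING-g10.md` §12.3 step (3); RULING 237(b)). Pure power-series algebra in the Cohen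
coordinates `κ⟦X₀, X₁, X₂, X₃⟧` of the hat ring (`X₀ = x, X₁ = y, X₂ = z̃, X₃ = w̃`), no run vocabulary:

* support bookkeeping for ideals generated by variables: `f ∈ (X_i : i ∈ V)^n` forces `Σ_{i ∈ V} β_i ≥ n` on
  every monomial `β` of `f` (`le_sum_of_mem_span_X_pow`);
* the NORMAL FORM: if `F = Q² + Σ_ν C_ν · L₂^{ν₀} L₃^{ν₁} + M` with `L₂ ≡ X₂`, `L₃ ≡ X₃ (mod (X₀, X₁))`,
  `M ∈ 𝔪^{d+1}`, the `ν` of degree `d` ODD, and `C_ν(0) = c̄_ν`, then the PURE coefficient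
  `F_{(0,0,a+1,b)}` (`a + 1 + b = d`) is `c̄_{(a+1,b)}` (`coeff_pure_eq`), hence
  `(∂F/∂X₂)_{(0,0,a,b)} = (a+1)·c̄_{(a+1,b)}` — the coefficient of `Z^a W^b` in `∂Ψ̄/∂Z` — and symmetrically for
  `∂/∂X₃` (`coeff_pure_pd_two`, `coeff_pure_pd_three`).

Characteristic `2` enters once: squares are supported on even exponents (tree `isSupportedOnMultiples_pow`), and a
pure exponent of odd degree is not even. Everything here is OURS, AI-written and AI-checked only; nothing is a
statement of [Hironaka2017]. -/

set_option linter.dupNamespace false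
set_option autoImplicit false

namespace Summit.ResolutionOfSingularities.ResolutionOfSingularities.Theorems.SwitchingDichotomy.BranchNormalForm

open MvPowerSeries
open IsLocalRing (maximalIdeal)
open Literature.RingTheory.MvPowerSeries (pd coeff_pd isSupportedOnMultiples_pow)
open Literature.RingTheory.MvPowerSeries.Jets (coeff_eq_zero_of_mem_maximalIdeal_pow mem_maximalIdeal_pow_iff)

variable {κ : Type*} [Field κ] {n : ℕ}

/-! ## §1 Ideals generated by a set of variables: support bookkeeping -/

/-- The ideal of series all of whose monomials have `V`-degree `≥ k`. OURS (auxiliary). -/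
theorem isIdeal_vdeg (V : Finset (Fin n)) (k : ℕ) :
    ∃ J : Ideal (MvPowerSeries (Fin n) κ), ∀ f, f ∈ J ↔ ∀ β : Fin n →₀ ℕ, (∑ i ∈ V, β i) < k → coeff β f = 0 := by
  classical
  refine ⟨{ carrier := {f | ∀ β : Fin n →₀ ℕ, (∑ i ∈ V, β i) < k → coeff β f = 0}
            add_mem' := fun {a b} ha hb β hβ => by rw [map_add, ha β hβ, hb β hβ, add_zero]
            zero_mem' := fun β _ => by simp
            smul_mem' := fun g f hf β hβ => ?_ }, fun f => Iff.rfl⟩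
  rw [smul_eq_mul, coeff_mul]
  refine Finset.sum_eq_zero fun p hp => ?_
  rw [Finset.HasAntidiagonal.mem_antidiagonal] at hp
  have h2 : (∑ i ∈ V, p.2 i) < k := by
    refine lt_of_le_of_lt (Finset.sum_le_sum fun i _ => ?_) hβ
    rw [← hp, Finsupp.add_apply]; omega
  rw [hf p.2 h2, mul_zero]

/-- **Support bookkeeping**: if `f ∈ (X_i : i ∈ V)^k` then every monomial of `f` has `V`-degree `≥ k`. OURS. -/
theorem le_vdeg_of_mem_span_X_pow (V : Finset (Fin n)) (k : ℕ) {f : MvPowerSeries (Fin n) κ}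
    (hf : f ∈ Ideal.span ((fun i => (X i : MvPowerSeries (Fin n) κ)) '' (V : Set (Fin n))) ^ k)
    (β : Fin n →₀ ℕ) (hβ : coeff β f ≠ 0) : k ≤ ∑ i ∈ V, β i := by
  classical
  -- `J m` := series whose monomials have `V`-degree `≥ m`
  have hJ : ∀ m : ℕ, ∃ J : Ideal (MvPowerSeries (Fin n) κ),
      ∀ g, g ∈ J ↔ ∀ β : Fin n →₀ ℕ, (∑ i ∈ V, β i) < m → coeff β g = 0 := fun m => isIdeal_vdeg V m
  choose J hJ using hJ
  -- the variable ideal lies in `J 1`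
  have hI : Ideal.span ((fun i => (X i : MvPowerSeries (Fin n) κ)) '' (V : Set (Fin n))) ≤ J 1 := by
    rw [Ideal.span_le]
    rintro _ ⟨i, hi, rfl⟩
    rw [SetLike.mem_coe, hJ]
    intro β hβ
    rw [coeff_X]
    rw [if_neg]
    rintro rfl
    rw [Finset.sum_eq_single_of_mem i (Finset.mem_coe.mp hi) (fun j _ hj => by simp [hj])] at hβ
    simp at hβ
  -- `J a * J b ≤ J (a + b)`
  have hmul : ∀ a b : ℕ, J a * J b ≤ J (a + b) := by
    intro a b
    rw [Ideal.mul_le]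
    intro f hf g hg
    rw [hJ] at hf hg ⊢
    intro β hβ
    rw [coeff_mul]
    refine Finset.sum_eq_zero fun p hp => ?_
    rw [Finset.HasAntidiagonal.mem_antidiagonal] at hp
    have hsplit : (∑ i ∈ V, p.1 i) + (∑ i ∈ V, p.2 i) = ∑ i ∈ V, β i := by
      rw [← Finset.sum_add_distrib]
      exact Finset.sum_congr rfl fun i _ => by rw [← Finsupp.add_apply, hp]
    by_cases h1 : (∑ i ∈ V, p.1 i) < a
    · rw [hf p.1 h1, zero_mul]
    · have h2 : (∑ i ∈ V, p.2 i) < b := by omega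
      rw [hg p.2 h2, mul_zero]
  -- `I^k ≤ J k`
  have hpow : ∀ m : ℕ, Ideal.span ((fun i => (X i : MvPowerSeries (Fin n) κ)) '' (V : Set (Fin n))) ^ m ≤ J m := by
    intro m
    induction m with
    | zero =>
      intro g _
      rw [hJ]; intro β hβ; omega
    | succ m ih =>
      rw [pow_succ]
      exact le_trans (Ideal.mul_mono ih hI) (hmul m 1)
  have hfJ := (hJ k f).mp (hpow k hf)
  by_contra hlt
  exact hβ (hfJ β (not_le.mp hlt))

/-- Series in the ideal `(X₀, X₁)` have no PURE `(X₂, X₃)`-monomials. OURS. -/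
theorem coeff_pure_eq_zero_of_mem_span01 {f : MvPowerSeries (Fin 4) κ}
    (hf : f ∈ Ideal.span {(X 0 : MvPowerSeries (Fin 4) κ), X 1}) (a b : ℕ) :
    coeff (Finsupp.single 2 a + Finsupp.single 3 b) f = 0 := by
  classical
  by_contra hne
  have hf' : f ∈ Ideal.span ((fun i => (X i : MvPowerSeries (Fin 4) κ)) '' (({0, 1} : Finset (Fin 4)) : Set (Fin 4))) ^ 1 := by
    rw [pow_one]
    refine Ideal.span_mono ?_ hf
    intro g hg
    simp only [Set.mem_insert_iff, Set.mem_singleton_iff] at hg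
    rcases hg with rfl | rfl
    · exact ⟨0, by simp, rfl⟩
    · exact ⟨1, by simp, rfl⟩
  have h := le_vdeg_of_mem_span_X_pow {0, 1} 1 hf' _ hne
  simp [Finsupp.single_apply] at h

/-! ## §2 Squares in characteristic `2` have even support -/

/-- In characteristic `2`, a PURE exponent `(0, 0, a, b)` of ODD total degree carries no coefficient of a square.
OURS. -/
theorem coeff_pure_sq_eq_zero [CharP κ 2] (Q : MvPowerSeries (Fin 4) κ) {a b : ℕ} (hab : Odd (a + b)) :
    coeff (Finsupp.single 2 a + Finsupp.single 3 b) (Q ^ 2) = 0 := by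
  haveI : ExpChar κ 2 := ExpChar.prime Nat.prime_two
  have h := isSupportedOnMultiples_pow 2 Q 1
  rw [pow_one] at h
  apply h
  by_cases ha : Odd a
  · exact ⟨2, by simpa [Finsupp.single_apply] using ha.not_two_dvd_nat⟩
  · have hb : Odd b := by
      have h1 : Odd a ↔ Even b := Nat.odd_add.mp hab
      exact Nat.not_even_iff_odd.mp fun hb => ha (h1.mpr hb)
    exact ⟨3, by simpa [Finsupp.single_apply] using hb.not_two_dvd_nat⟩

/-! ## §3 The normal form: pure coefficients of `F` and of `∂F` -/

/-- `X₂^i X₃^j` is the monic monomial with exponent `(0, 0, i, j)`. OURS. -/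
theorem X_two_pow_mul_X_three_pow (i j : ℕ) :
    (X 2 : MvPowerSeries (Fin 4) κ) ^ i * X 3 ^ j = monomial (Finsupp.single 2 i + Finsupp.single 3 j) 1 := by
  rw [X_pow_eq, X_pow_eq, monomial_mul_monomial, one_mul]

/-- Pure exponents are determined by their two entries. OURS. -/
theorem pure_eq_pure_iff (i j a b : ℕ) :
    Finsupp.single (2 : Fin 4) i + Finsupp.single 3 j = Finsupp.single 2 a + Finsupp.single 3 b ↔ i = a ∧ j = b := by
  constructor
  · intro h
    have h2 := DFunLike.congr_fun h 2
    have h3 := DFunLike.congr_fun h 3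
    simp at h2 h3
    exact ⟨h2, h3⟩
  · rintro ⟨rfl, rfl⟩; rfl

/-- The pure coefficient of `L₂^i L₃^j` for linear forms `L₂ ≡ X₂`, `L₃ ≡ X₃ (mod (X₀, X₁))`:
it is `1` at `(0,0,i,j)` and `0` at every other pure exponent. OURS. -/
theorem coeff_pure_linearPow (A B A' B' : MvPowerSeries (Fin 4) κ) (i j a b : ℕ) :
    coeff (Finsupp.single 2 a + Finsupp.single 3 b)
        ((X 2 + X 0 * A + X 1 * B) ^ i * (X 3 + X 0 * A' + X 1 * B') ^ j) =
      if i = a ∧ j = b then 1 else 0 := by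
  classical
  set I : Ideal (MvPowerSeries (Fin 4) κ) := Ideal.span {(X 0 : MvPowerSeries (Fin 4) κ), X 1} with hI
  have hX0 : (X 0 : MvPowerSeries (Fin 4) κ) ∈ I := Ideal.subset_span (by simp)
  have hX1 : (X 1 : MvPowerSeries (Fin 4) κ) ∈ I := Ideal.subset_span (by simp)
  -- congruence modulo `I`
  have hdiff : (X 2 + X 0 * A + X 1 * B) ^ i * (X 3 + X 0 * A' + X 1 * B') ^ j - X 2 ^ i * X 3 ^ j ∈ I := by
    rw [← Ideal.Quotient.eq]
    have h2 : Ideal.Quotient.mk I (X 2 + X 0 * A + X 1 * B) = Ideal.Quotient.mk I (X 2) := by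
      rw [Ideal.Quotient.eq]
      have : X 2 + X 0 * A + X 1 * B - (X 2 : MvPowerSeries (Fin 4) κ) = X 0 * A + X 1 * B := by ring
      rw [this]
      exact I.add_mem (I.mul_mem_right _ hX0) (I.mul_mem_right _ hX1)
    have h3 : Ideal.Quotient.mk I (X 3 + X 0 * A' + X 1 * B') = Ideal.Quotient.mk I (X 3) := by
      rw [Ideal.Quotient.eq]
      have : X 3 + X 0 * A' + X 1 * B' - (X 3 : MvPowerSeries (Fin 4) κ) = X 0 * A' + X 1 * B' := by ring
      rw [this]
      exact I.add_mem (I.mul_mem_right _ hX0) (I.mul_mem_right _ hX1)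
    rw [map_mul, map_pow, map_pow, h2, h3, ← map_pow, ← map_pow, ← map_mul]
  have hzero := coeff_pure_eq_zero_of_mem_span01 hdiff a b
  rw [map_sub, sub_eq_zero] at hzero
  rw [hzero, X_two_pow_mul_X_three_pow, coeff_monomial]
  simp only [pure_eq_pure_iff]
  by_cases h : i = a ∧ j = b
  · rw [if_pos h, if_pos ⟨h.1.symm, h.2.symm⟩]
  · rw [if_neg h, if_neg (fun h' => h ⟨h'.1.symm, h'.2.symm⟩)]

/-- **NORMAL FORM — pure coefficients of `F`** (memo §12.3 (3)). In `κ⟦X₀..X₃⟧` of characteristic `2`, let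
`F = Q² + Σ_{ν ∈ S} C_ν · L₂^{ν₀} L₃^{ν₁} + M` with `L₂ = X₂ + X₀A + X₁B`, `L₃ = X₃ + X₀A′ + X₁B′`, every `ν ∈ S`
of degree `d` with `d` ODD, and `M ∈ 𝔪^{d+1}`. Then for `a + b = d` the pure coefficient `F_{(0,0,a,b)}` equals
`C_{(a,b)}(0)` (and `0` if `(a, b) ∉ S`). OURS. -/
theorem coeff_pure_eq [CharP κ 2] {d : ℕ} (hd : Odd d) (F Q M A B A' B' : MvPowerSeries (Fin 4) κ)
    (S : Finset (Fin 2 →₀ ℕ)) (Cν : (Fin 2 →₀ ℕ) → MvPowerSeries (Fin 4) κ)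
    (hS : ∀ ν ∈ S, ν 0 + ν 1 = d) (hM : M ∈ maximalIdeal (MvPowerSeries (Fin 4) κ) ^ (d + 1))
    (hF : F = Q ^ 2 + (∑ ν ∈ S, Cν ν * ((X 2 + X 0 * A + X 1 * B) ^ (ν 0) * (X 3 + X 0 * A' + X 1 * B') ^ (ν 1))) + M)
    {a b : ℕ} (hab : a + b = d) :
    coeff (Finsupp.single 2 a + Finsupp.single 3 b) F =
      ∑ ν ∈ S, if ν = Finsupp.single 0 a + Finsupp.single 1 b then constantCoeff (Cν ν) else 0 := by
  classical
  set β : Fin 4 →₀ ℕ := Finsupp.single 2 a + Finsupp.single 3 b with hβ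
  have hβdeg : β.degree = d := by
    rw [hβ, map_add, Finsupp.degree_single, Finsupp.degree_single, hab]
  rw [hF, map_add, map_add, coeff_pure_sq_eq_zero Q (hab ▸ hd), zero_add,
    coeff_eq_zero_of_mem_maximalIdeal_pow hM (by rw [hβdeg]; omega), add_zero, map_sum]
  refine Finset.sum_congr rfl fun ν hν => ?_
  have hνd := hS ν hν
  -- split the coefficient series into its constant term and a part in `𝔪`
  set L := (X 2 + X 0 * A + X 1 * B) ^ (ν 0) * (X 3 + X 0 * A' + X 1 * B') ^ (ν 1) with hL
  have hLmem : L ∈ maximalIdeal (MvPowerSeries (Fin 4) κ) ^ d := by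
    have h2 : (X 2 + X 0 * A + X 1 * B : MvPowerSeries (Fin 4) κ) ∈ maximalIdeal _ := by
      rw [Literature.RingTheory.MvPowerSeries.Jets.mem_maximalIdeal_iff_constantCoeff_eq_zero]; simp
    have h3 : (X 3 + X 0 * A' + X 1 * B' : MvPowerSeries (Fin 4) κ) ∈ maximalIdeal _ := by
      rw [Literature.RingTheory.MvPowerSeries.Jets.mem_maximalIdeal_iff_constantCoeff_eq_zero]; simp
    rw [hL, ← hνd, pow_add]
    exact Ideal.mul_mem_mul (Ideal.pow_mem_pow h2 _) (Ideal.pow_mem_pow h3 _)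
  have hsplit : Cν ν * L = C (constantCoeff (Cν ν)) * L + (Cν ν - C (constantCoeff (Cν ν))) * L := by ring
  have htail : (Cν ν - C (constantCoeff (Cν ν))) * L ∈ maximalIdeal (MvPowerSeries (Fin 4) κ) ^ (d + 1) := by
    rw [pow_succ']
    refine Ideal.mul_mem_mul ?_ hLmem
    rw [Literature.RingTheory.MvPowerSeries.Jets.mem_maximalIdeal_iff_constantCoeff_eq_zero]
    simp
  rw [hsplit, map_add, coeff_eq_zero_of_mem_maximalIdeal_pow htail (by rw [hβdeg]; omega), add_zero,
    coeff_C_mul, hL, coeff_pure_linearPow]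
  by_cases h : ν 0 = a ∧ ν 1 = b
  · have hν : ν = Finsupp.single 0 a + Finsupp.single 1 b := by
      ext s; fin_cases s <;> simp [h.1, h.2]
    rw [if_pos h, if_pos hν, mul_one]
  · have hν : ν ≠ Finsupp.single 0 a + Finsupp.single 1 b := by
      intro e; apply h
      rw [e]; simp
    rw [if_neg h, if_neg hν, mul_zero]

/-- **Pure coefficients of `∂F/∂X₂`**: `(∂₂F)_{(0,0,a,b)} = (a + 1)·F_{(0,0,a+1,b)}`. OURS. -/
theorem coeff_pure_pd_two (F : MvPowerSeries (Fin 4) κ) (a b : ℕ) :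
    coeff (Finsupp.single 2 a + Finsupp.single 3 b) (pd 2 F) =
      ((a + 1 : ℕ) : κ) * coeff (Finsupp.single 2 (a + 1) + Finsupp.single 3 b) F := by
  have h1 : (Finsupp.single (2 : Fin 4) a + Finsupp.single 3 b : Fin 4 →₀ ℕ) 2 = a := by simp
  have h2 : Finsupp.single (2 : Fin 4) a + Finsupp.single 3 b + Finsupp.single 2 1 =
      Finsupp.single 2 (a + 1) + Finsupp.single 3 b := by
    ext s; fin_cases s <;> simp
  rw [coeff_pd, h1, h2]

/-- **Pure coefficients of `∂F/∂X₃`**: `(∂₃F)_{(0,0,a,b)} = (b + 1)·F_{(0,0,a,b+1)}`. OURS. -/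
theorem coeff_pure_pd_three (F : MvPowerSeries (Fin 4) κ) (a b : ℕ) :
    coeff (Finsupp.single 2 a + Finsupp.single 3 b) (pd 3 F) =
      ((b + 1 : ℕ) : κ) * coeff (Finsupp.single 2 a + Finsupp.single 3 (b + 1)) F := by
  have h1 : (Finsupp.single (2 : Fin 4) a + Finsupp.single 3 b : Fin 4 →₀ ℕ) 3 = b := by simp
  have h2 : Finsupp.single (2 : Fin 4) a + Finsupp.single 3 b + Finsupp.single 3 1 =
      Finsupp.single 2 a + Finsupp.single 3 (b + 1) := by
    ext s; fin_cases s <;> simp [add_assoc]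
  rw [coeff_pd, h1, h2]

end Summit.ResolutionOfSingularities.ResolutionOfSingularities.Theorems.SwitchingDichotomy.BranchNormalForm
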